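import Summits.QuantumFields.BalabanUV.T4Continuum.Support.OutputRateTowerArithmetic
import Summits.QuantumFields.BalabanUV.T4Continuum.Support.OutputRateTowerInstanceCovariant

/-!
# OutputRateTowerArithmeticRate — the REMAINING END faces of row NE5's tower-reading road with the arithmetic letters `k₀, B, k₁, ρ₁`
# ELIMINATED — each ONE application of its parent after `OutputRateTowerArithmetic` §0's sign-free letter witnesses (cell `pub-balaban`,
# T⁴ fan-out, row NE5; NE5 swarm, claim-table row O6-n NUMERICS, lineage follower #3b; unit `b2b-balaban-t4-ne5-formalise-leaf-10`;
# LEAN PLACEMENT RULE 2026-08-19: our bookkeeping lives under `Summits/`)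

HONEST FRAMING (T4-DAG PAGE 1).  Rung (B)+1: existence AND uniqueness of the ε → 0 limit of Bałaban's unit-scale gauge-invariant
expectations on a FIXED finite torus T⁴ — NOT infinite volume, NOT a mass gap, NOT the Clay problem.  NE5 (`T4OutputRate.NE5`) is NOT
PRINTED (cell GAPS G-t4-U3-1) and NOT PROVED here: real arithmetic over the DISPLAYED binders of LANDED END faces, each APPLIED BY NAME
(`OutputRateTowerInstance.ne5_at_of_perturbed_lip_readsIns_nat` ∕ `…_plantedPotential_lip_readsIns_nat` p205877∕p206294, owner g27;
`OutputRateTowerInstanceCovariant.ne5_at_of_colourCovariantLaplacian_lip_readsIns_nat` p213444, owner g28; `OutputRateTowerBalabanRate.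
ne5_at_of_balaban_{lip,split}_readsIns_rate_nat` p219950, owner g33).  Nothing printed is asserted; 0 cite tags; no `def … : Prop`.
Spine PROVED 0/9; leaves on Bałaban's concrete objects 0/12 (O1 = substrate cell).  HONEST DEPENDENCY (cell, verbatim): continuum YM on
T⁴ ⇐ BetaPertH ∧ nine spine estimates (0/9 proved); BetaPertH ⇐ (D1) ∧ (D4) ∧ CAP+tail; G-an2-4 gates asym, D1 and NE2/3/4.

WHAT EACH FACE IS: its parent with `k₀, B∕Bc, k₁, ρ₁` and the binders `hρ₁`, `hreach`, `hnear`, `hB∕hBc`, `hfirst` REPLACED by the strict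
reach `c·(EA₀ + E₀)/(1 − ω) < ρ₀` and a rate STRICTLY below one (`θ < 1` for the rate-`θ` faces, where it also replaces `θ ≤ 1`; `1 < L`
for the rate-`L⁻¹` faces); conclusion `∃ C₅, NE5 EA EB W κ θ′ C₅` at the prescribed `θ′`.  Sharpness: `OutputRateTowerArithmetic.tower_letters_iff`.
With `OutputRateTowerArithmetic` (p220788: socket ×2 + rate face, uniform face, perturbed split, Bałaban tier-B at `L⁻¹`, the `NE3Shape` face)
every W4-PRODUCED (`readsIns`) tower-road END face in the tree has its letters-free twin (10∕10); `…_anyRate_nat` is the corollary form at rate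
`max θ L⁻¹`, covered by §2 ∕ the `NE3Shape` face; the W4-DISPLAYED and THRESHOLD socket faces reduce by `reach_binders_exists_any` in one line.  No letter of Bałaban's is given a value.  Provenance: NE5 swarm seat
leaf-10 (gen 7), 2026-08-20; census `HOME/t4/b2b-balaban-t4-ne5-formalise-leaf-10/B13SmallnessCensus.md` §11 (A15).
-/

noncomputable section

open Set Metric
open scoped Matrix Matrix.Norms.L2Operator Kronecker

namespace Summit.QuantumFields.BalabanUV.T4Continuum.OutputRateTowerArithmeticRate

open Literature.MathematicalPhysics.QuantumFieldTheory.Balaban1983to89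
open Literature.MathematicalPhysics.QuantumFieldTheory.Balaban1983to89.B5Prop11Plancherel (Cst Tor fine)
open Literature.MathematicalPhysics.QuantumFieldTheory.Balaban1983to89.B5G183RateUnitTower (lev lev_neZero)
open Literature.MathematicalPhysics.QuantumFieldTheory.Balaban1983to89.T4OutputRate
open Literature.MathematicalPhysics.QuantumFieldTheory.Balaban1983to89.T4InputCauchyRate
open Literature.MathematicalPhysics.QuantumFieldTheory.Balaban1983to89.T4InputCauchyRateData
open Literature.MathematicalPhysics.QuantumFieldTheory.Balaban1983to89.T4OperatorRateLiaison
open Literature.MathematicalPhysics.QuantumFieldTheory.Balaban1983to89.T4EtaRateMin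
open Summit.QuantumFields.BalabanUV.T4Continuum.CovariantAveragingTower
open Summit.QuantumFields.BalabanUV.T4Continuum.BackgroundResolventTower
open Summit.QuantumFields.BalabanUV.T4Continuum.OutputRateInsertion
open Summit.QuantumFields.BalabanUV.T4Continuum.OutputRateTowerSocket
open Summit.QuantumFields.BalabanUV.T4Continuum.OutputRateTowerInstance
open Summit.QuantumFields.BalabanUV.T4Continuum.OutputRateTowerInstanceCovariant
open Summit.QuantumFields.BalabanUV.T4Continuum.OutputRateTowerBalabanRate
open Summit.QuantumFields.BalabanUV.T4Continuum.OutputRateArithmetic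
open Summit.QuantumFields.BalabanUV.T4Continuum.OutputRateTowerArithmetic

/-! ## §1 Row NE2's perturbed free towers, non-split reading -/

section Perturbed

variable {ι : ℕ → Type*} [∀ k, Fintype (ι k)] [∀ k, DecidableEq (ι k)]
variable {Jx : Type*} {D : (k : ℕ) → Matrix (ι k) (ι k) ℂ} {A : (k : ℕ) → Matrix (ι k) (ι (k + 1)) ℂ}
  {Jinj : (k : ℕ) → Matrix (ι (k + 1)) (ι k) ℂ} {F : (k : ℕ) → Matrix (ι k) (ι k) ℂ} {r κP : ℝ} {e₀ e₁ f : ℕ → ℝ}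
  {e₂ : Jx → ℕ → ℝ} {P : Jx → (k : ℕ) → Matrix (ι k) (ι k) ℂ} {C₀ C₁ C₂ Cf : ℝ} {t : ℂ}
variable {C : Carriers} {Op Hist : Type*} [NormedAddCommGroup Op] [NormedSpace ℂ Op] [NormedAddCommGroup Hist]
  [NormedSpace ℂ Hist] [CompleteSpace Hist] (M : StepModel C Op Hist)

/-- [folklore] `OutputRateTowerInstance.ne5_at_of_perturbed_lip_readsIns_nat` (W1 := the perturbed-tower instance read by `ReadsTower`,
W4 produced; `hδ : cR·Cpert(t)/r₀ = δ`) with the arithmetic letters eliminated.  NOT a proof of NE5. -/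
theorem exists_ne5_at_of_perturbed_lip_readsIns_nat (Ins : ℕ → Op → (C.Dom → ℝ) → Hist) {W : Set (ℕ → ℝ)} {cR r₀ δ : ℝ}
    {tow : ℕ → (ℕ → ℝ) → C.BgB → Jx} {EA : Functional C C.BgA} {EB : Functional C C.BgB}
    {κ Λ EA₀ E₀ Gi θ θ' c ω ρ₀ : ℝ} (hr : 0 < r) (hfree : FreeTowerLaws D A Jinj F r e₀ e₁ f)
    (hpert : ∀ j, PerturbationLaws D (P j) Jinj κP (e₂ j)) (h₀ : ∀ k, e₀ k ≤ C₀ * θ ^ k) (h₁ : ∀ k, e₁ k ≤ C₁ * θ ^ k)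
    (h₂ : ∀ j k, e₂ j k ≤ C₂ * θ ^ k) (hf : ∀ k, f k ≤ Cf * θ ^ k) (hC₀ : 0 ≤ C₀) (hC₁ : 0 ≤ C₁) (hC₂ : 0 ≤ C₂)
    (hCf : 0 ≤ Cf) (ht : ‖t‖ * κP < 1) (hread : ReadsTower M (fun _ : Jx => A) (pertTower D P t) r W cR tow)
    (hcR : 0 ≤ cR) (hfl : ∀ k, r₀ ≤ M.rOp k) (hr₀ : 0 < r₀) (hδ : cR * Cpert κP C₀ C₁ C₂ Cf t / r₀ = δ)
    (hrA : M.RepresentsA EA W) (hrB : M.RepresentsB EB W) (hbase : M.InBase EB W) (hlip : M.DataLipschitz W κ Λ ρ₀)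
    (hdA : DecayBound EA W EA₀ κ) (hdB : DecayBound EB W E₀ κ) (hreadI : (InsOpModel.ofStep M Ins).ReadsIns W)
    (hienv : (InsOpModel.ofStep M Ins).InsOpEnvelope W κ E₀ Gi) (hbdA : (InsOpModel.ofStep M Ins).InsBoundA W κ E₀ Gi)
    (hGi : 0 ≤ Gi) (hdamp : M.InsertionDampedNat W κ c ω) (hΛ : 0 ≤ Λ) (hθ0 : 0 < θ) (hθ1 : θ < 1) (hθθ' : θ ≤ θ')
    (hθ'1 : θ' ≤ 1) (hc : 0 ≤ c) (hω : 0 < ω) (hreachρ : c * (EA₀ + E₀) / (1 - ω) < ρ₀) (hsmall : ω + Λ * c < θ') :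
    ∃ C₅, NE5 EA EB W κ θ' C₅ := by
  obtain ⟨k₁, hk₁⟩ := insReach_exists_any (δ := δ) hθ1
  obtain ⟨k₀, B, hB, hnear, hfirst⟩ :=
    reach_binders_exists_any (D := δ + (Gi * δ / (1 - 1 / 2) + 2 * Gi / θ ^ k₁)) hθ0 hθ1 hreachρ
  exact ⟨_, ne5_at_of_perturbed_lip_readsIns_nat M Ins hr hfree hpert h₀ h₁ h₂ hf hC₀ hC₁ hC₂ hCf ht hread hcR hfl hr₀ hδ hrA hrB
    hbase hlip hdA hdB hreadI hienv hbdA hGi (by norm_num) hk₁ hdamp hΛ hθ0 hθθ' hθ'1 hc hω hnear hB hfirst hsmall⟩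

end Perturbed

/-! ## §2 Bałaban's typed tier-B operator at a general NE3 rate `θ ∈ [L⁻¹, 1)` -/

section BalabanRate

open Summit.QuantumFields.BalabanUV.T4Continuum.BalabanAveragedTowerUnit (idx Qlev)
open Summit.QuantumFields.BalabanUV.T4Continuum.KingPairingPlantedLaw (calDalev CJ)
open Summit.QuantumFields.BalabanUV.T4Continuum.GramPerturbationLaw (C2gram)
open Summit.QuantumFields.BalabanUV.T4Continuum.NE2FromNE3 (bgReadings)
open Summit.QuantumFields.BalabanUV.T4Continuum.RegularBackgroundTower (RegularTransporters regClass betaNE3)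
open Summit.QuantumFields.BalabanUV.T4Continuum.GaugeTermScalarData (QuT Q1)
open Summit.QuantumFields.BalabanUV.T4Continuum.RegularSiteTransporters (siteT)
open Summit.QuantumFields.BalabanUV.T4Continuum.NestedContourTransport (theta0)
open Summit.QuantumFields.BalabanUV.T4Continuum.NE2BalabanRoot (balabanPert)
open Summit.QuantumFields.BalabanUV.T4Continuum.NE2BalabanGauge (gaugeSlot liftR)
open Summit.QuantumFields.BalabanUV.T4Continuum.NE2BalabanLayerSharp (kappaBs C2Bs)
open Summit.QuantumFields.BalabanUV.T4Continuum.NE2BalabanWiring (epsR CdeltaR)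
open Summit.QuantumFields.BalabanUV.T4Continuum.NE2BalabanFinal (kappa4F C4F)
open Summit.QuantumFields.BalabanUV.T4Continuum.NE2BalabanThreshold (etaStar)
open Summit.QuantumFields.BalabanUV.T4Continuum.NE2FromNE3Carrier (ne2Loc)
open Summit.QuantumFields.BalabanUV.T4Continuum.MinimalActionRate (minActReadings)

variable {d : ℕ} (L : ℕ) [NeZero L] (Mf : Fin d → ℕ) [∀ μ, NeZero (Mf μ)] (a : ℝ) (ha : 0 < a)
variable {o : Type*} [Fintype o] [DecidableEq o]
variable {Jx : Type*} {Rg : Jx → ((k : ℕ) → Fin d → (Tor (fine (lev L k) Mf) → Matrix o o ℂ))} {α β Cn θ a' η : ℝ}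
variable {Cr : Carriers} {Op Hist : Type*} [NormedAddCommGroup Op] [NormedSpace ℂ Op] [NormedAddCommGroup Hist]
  [NormedSpace ℂ Hist] [CompleteSpace Hist] (Mdl : StepModel Cr Op Hist)

/-- [folklore] `OutputRateTowerBalabanRate.ne5_at_of_balaban_lip_readsIns_rate_nat` (family `Rg j`, node NE3's `LocalRate … C θ` per member at a
rate `L⁻¹ ≤ θ`, W4 produced) with the arithmetic letters eliminated; `θ ≤ 1` sharpened to `θ < 1`.  Model level (no B0); NOT a proof of NE5. -/
theorem exists_ne5_at_of_balaban_lip_readsIns_rate_nat (Ins : ℕ → Op → (Cr.Dom → ℝ) → Hist) (hJ : Nonempty Jx) (hd : 1 ≤ d)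
    (hreg : ∀ j, RegularTransporters L Mf (liftR L Mf (Rg j)) α β) (hα : 0 ≤ α) (hβ : 0 ≤ β) (hC : 0 ≤ Cn)
    (hθ : ((L : ℝ)⁻¹) ≤ θ) (hθ1 : θ < 1)
    (hNE3θ : ∀ j, LocalRate (bgReadings L Mf (regClass L Mf (liftR L Mf (Rg j)))) Cn θ) (ha' : 0 < a')
    (hαη : α ≤ η) (hβη : β ≤ η) (hη : η ≤ etaStar o d a a')
    {W : Set (ℕ → ℝ)} {cR r₀ δ : ℝ} {tow : ℕ → (ℕ → ℝ) → Cr.BgB → Jx} {EA : Functional Cr Cr.BgA} {EB : Functional Cr Cr.BgB}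
    {κ Λ EA₀ E₀ Gi θ' c ω ρ₀ : ℝ}
    (hread : ReadsTower Mdl (fun _ : Jx => fun k => Qlev L Mf k ⊗ₖ (1 : Matrix o o ℂ))
      (pertTower (fun k => calDalev L Mf a ha k ⊗ₖ (1 : Matrix o o ℂ))
        (fun j => balabanPert L Mf a (liftR L Mf (Rg j)) (gaugeSlot L Mf (Rg j) (QuT L Mf o (siteT L Mf (Rg j))) (Q1 L Mf o) a')) 1)
      ((L : ℝ) ^ d) W cR tow)
    (hcR : 0 ≤ cR) (hfl : ∀ k, r₀ ≤ Mdl.rOp k) (hr₀ : 0 < r₀)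
    (hδ : cR * Cpert (kappaBs o d a α β (a * (epsR o d α * (2 + epsR o d α) * Cst d a)) (kappa4F d a a' α β))
        (2 * d * Cst d a) (CJ d a)
        (C2Bs o d L a α β Cn
          (a * C2gram (Cst d a) 1 (epsR o d α) (2 * d * Cst d a) (CJ d a) (Cst d a) (CdeltaR o d a α (theta0 d α (betaNE3 o Cn))))
          (C4F o d L a a' α β Cn)) 0 1 / r₀ = δ)
    (hrA : Mdl.RepresentsA EA W) (hrB : Mdl.RepresentsB EB W) (hbase : Mdl.InBase EB W) (hlip : Mdl.DataLipschitz W κ Λ ρ₀)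
    (hdA : DecayBound EA W EA₀ κ) (hdB : DecayBound EB W E₀ κ) (hreadI : (InsOpModel.ofStep Mdl Ins).ReadsIns W)
    (hienv : (InsOpModel.ofStep Mdl Ins).InsOpEnvelope W κ E₀ Gi) (hbdA : (InsOpModel.ofStep Mdl Ins).InsBoundA W κ E₀ Gi)
    (hGi : 0 ≤ Gi) (hdamp : Mdl.InsertionDampedNat W κ c ω) (hΛ : 0 ≤ Λ) (hθθ' : θ ≤ θ') (hθ'1 : θ' ≤ 1) (hc : 0 ≤ c)
    (hω : 0 < ω) (hreachρ : c * (EA₀ + E₀) / (1 - ω) < ρ₀) (hsmall : ω + Λ * c < θ') : ∃ C₅, NE5 EA EB W κ θ' C₅ := by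
  have hL : (0 : ℝ) < L := by exact_mod_cast Nat.pos_of_ne_zero (NeZero.ne L)
  have hθ0 : 0 < θ := lt_of_lt_of_le (inv_pos.mpr hL) hθ
  obtain ⟨k₁, hk₁⟩ := insReach_exists_any (δ := δ) hθ1
  obtain ⟨k₀, Bc, hBc, hnear, hfirst⟩ :=
    reach_binders_exists_any (D := δ + (Gi * δ / (1 - 1 / 2) + 2 * Gi / θ ^ k₁)) hθ0 hθ1 hreachρ
  exact ⟨_, ne5_at_of_balaban_lip_readsIns_rate_nat L Mf a ha Mdl Ins hJ hd hreg hα hβ hC hθ hθ1.le hNE3θ ha' hαη hβη hη hread hcR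
    hfl hr₀ hδ hrA hrB hbase hlip hdA hdB hreadI hienv hbdA hGi (by norm_num) hk₁ hdamp hΛ hθθ' hθ'1 hc hω hnear hBc hfirst hsmall⟩

variable {𝒞 : ℕ → Set (B7Prop1Explicit.Site d → Fin d → (Matrix o o ℂ)ˣ)} {N : ℕ}
  {dom : Set (B7Prop1Explicit.Site d → Fin d → (Matrix o o ℂ)ˣ)}
  {Rd : (B7Prop1Explicit.Site d → Fin d → (Matrix o o ℂ)ˣ) → ((k : ℕ) → Fin d → (Tor (fine (lev L k) Mf) → Matrix o o ℂ))}

/-- [folklore] `OutputRateTowerBalabanRate.ne5_at_of_balaban_split_readsIns_rate_nat` (minimiser split at a rate `L⁻¹ ≤ θ`, ONE NE3-type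
hypothesis `LocalRate (minActReadings …) C θ` feeding both legs, W4 produced) with the arithmetic letters eliminated; `θ ≤ 1` sharpened to
`θ < 1`.  `Rd` DATA (no B0); NOT a proof of NE5. -/
theorem exists_ne5_at_of_balaban_split_readsIns_rate_nat (Ins : ℕ → Op → (Cr.Dom → ℝ) → Hist) (hne : dom.Nonempty) (hd : 1 ≤ d)
    (hreg : ∀ V ∈ dom, RegularTransporters L Mf (liftR L Mf (Rd V)) α β) (hα : 0 ≤ α) (hβ : 0 ≤ β) (hC : 0 ≤ Cn)
    (hθ : ((L : ℝ)⁻¹) ≤ θ) (hθ1 : θ < 1)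
    (hNE3 : LocalRate (minActReadings d 𝒞 L N dom (ne2Loc L Mf fun V => liftR L Mf (Rd V))) Cn θ) (ha' : 0 < a')
    (hαη : α ≤ η) (hβη : β ≤ η) (hη : η ≤ etaStar o d a a')
    {W : Set (ℕ → ℝ)} {cR r₀ Λb δ : ℝ} {tow : ℕ → (ℕ → ℝ) → Cr.BgB → ↥dom} (opMid : (ℕ → ℝ) → Cr.BgB → ℕ → Op)
    (dist : ℕ → (ℕ → ℝ) → Cr.BgB → ℝ) {EA : Functional Cr Cr.BgA} {EB : Functional Cr Cr.BgB} {κ Λ EA₀ E₀ Gi θ' c ω ρ₀ : ℝ}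
    (hread : ReadsTowerMid Mdl (fun _ : ↥dom => fun k => Qlev L Mf k ⊗ₖ (1 : Matrix o o ℂ))
      (pertTower (fun k => calDalev L Mf a ha k ⊗ₖ (1 : Matrix o o ℂ))
        (fun V : ↥dom => balabanPert L Mf a (liftR L Mf (Rd V)) (gaugeSlot L Mf (Rd V) (QuT L Mf o (siteT L Mf (Rd V))) (Q1 L Mf o) a'))
        1)
      ((L : ℝ) ^ d) W cR tow opMid)
    (hcR : 0 ≤ cR) (hfl : ∀ k, r₀ ≤ Mdl.rOp k) (hr₀ : 0 < r₀)
    (hLip : ∀ k, ∀ g ∈ W, ∀ (U : Cr.BgB), ‖opMid g U k - Mdl.opB g U k‖ ≤ Λb * dist k g U * Mdl.rOp k) (hΛb : 0 ≤ Λb)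
    (hdom : ∀ k, ∀ g ∈ W, ∀ (U : Cr.BgB), ∃ V ∈ dom, ∃ x : Bool × NE2FromNE3.Site L Mf o,
      dist k g U ≤ |ne2Loc L Mf (fun V => liftR L Mf (Rd V)) (k + 1) V x - ne2Loc L Mf (fun V => liftR L Mf (Rd V)) k V x|)
    (hδ : cR * Cpert (kappaBs o d a α β (a * (epsR o d α * (2 + epsR o d α) * Cst d a)) (kappa4F d a a' α β))
        (2 * d * Cst d a) (CJ d a)
        (C2Bs o d L a α β Cn
          (a * C2gram (Cst d a) 1 (epsR o d α) (2 * d * Cst d a) (CJ d a) (Cst d a) (CdeltaR o d a α (theta0 d α (betaNE3 o Cn))))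
          (C4F o d L a a' α β Cn)) 0 1 / r₀ + Λb * Cn = δ)
    (hrA : Mdl.RepresentsA EA W) (hrB : Mdl.RepresentsB EB W) (hbase : Mdl.InBase EB W) (hlip : Mdl.DataLipschitz W κ Λ ρ₀)
    (hdA : DecayBound EA W EA₀ κ) (hdB : DecayBound EB W E₀ κ) (hreadI : (InsOpModel.ofStep Mdl Ins).ReadsIns W)
    (hienv : (InsOpModel.ofStep Mdl Ins).InsOpEnvelope W κ E₀ Gi) (hbdA : (InsOpModel.ofStep Mdl Ins).InsBoundA W κ E₀ Gi)
    (hGi : 0 ≤ Gi) (hdamp : Mdl.InsertionDampedNat W κ c ω) (hΛ : 0 ≤ Λ) (hθθ' : θ ≤ θ') (hθ'1 : θ' ≤ 1) (hc : 0 ≤ c)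
    (hω : 0 < ω) (hreachρ : c * (EA₀ + E₀) / (1 - ω) < ρ₀) (hsmall : ω + Λ * c < θ') : ∃ C₅, NE5 EA EB W κ θ' C₅ := by
  have hL : (0 : ℝ) < L := by exact_mod_cast Nat.pos_of_ne_zero (NeZero.ne L)
  have hθ0 : 0 < θ := lt_of_lt_of_le (inv_pos.mpr hL) hθ
  obtain ⟨k₁, hk₁⟩ := insReach_exists_any (δ := δ) hθ1
  obtain ⟨k₀, Bc, hBc, hnear, hfirst⟩ :=
    reach_binders_exists_any (D := δ + (Gi * δ / (1 - 1 / 2) + 2 * Gi / θ ^ k₁)) hθ0 hθ1 hreachρ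
  exact ⟨_, ne5_at_of_balaban_split_readsIns_rate_nat L Mf a ha Mdl Ins hne hd hreg hα hβ hC hθ hθ1.le hNE3 ha' hαη hβη hη opMid dist
    hread hcR hfl hr₀ hLip hΛb hdom hδ hrA hrB hbase hlip hdA hdB hreadI hienv hbdA hGi (by norm_num) hk₁ hdamp hΛ hθθ' hθ'1 hc hω
    hnear hBc hfirst hsmall⟩

end BalabanRate

/-! ## §3 The rate-`L⁻¹` instances of `OutputRateTowerInstance[Covariant]`: covariant-Laplacian class; King's planted class -/

section RateL

open Literature.MathematicalPhysics.QuantumFieldTheory.Balaban1983to89.B5Prop11Plancherel (Cst)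
open Summit.QuantumFields.BalabanUV.T4Continuum.BalabanAveragedTowerUnit (idx Qlev)
open Summit.QuantumFields.BalabanUV.T4Continuum.KingPairingPlantedLaw (calDalev CJ)
open Summit.QuantumFields.BalabanUV.T4Continuum.PlantedPotentialRate (plantTow)
open Summit.QuantumFields.BalabanUV.T4Continuum.FirstOrderBackgroundModel (LipschitzBackground)
open Summit.QuantumFields.BalabanUV.T4Continuum.PerturbationAlgebra (BoundedBackground)
open Summit.QuantumFields.BalabanUV.T4Continuum.ColourCovariantLaplacian (kappaCol C2col covPertC Vab Zab)

variable {d : ℕ} (L : ℕ) [NeZero L] (Mf : Fin d → ℕ) [∀ μ, NeZero (Mf μ)] (a : ℝ) (ha : 0 < a)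
variable {o : Type*} [Fintype o] [DecidableEq o]
variable {C : Carriers} {Op Hist : Type*} [NormedAddCommGroup Op] [NormedSpace ℂ Op] [NormedAddCommGroup Hist]
  [NormedSpace ℂ Hist] [CompleteSpace Hist] (Mdl : StepModel C Op Hist)

/-- [folklore] `OutputRateTowerInstanceCovariant.ne5_at_of_colourCovariantLaplacian_lip_readsIns_nat` (the covariant-Laplacian class, rate `L⁻¹`)
with the arithmetic letters eliminated; needs `1 < L`.  MODEL LEVEL; NOT a proof of NE5. -/
theorem exists_ne5_at_of_colourCovariantLaplacian_lip_readsIns_nat (hL1 : 1 < L) (hd : 1 ≤ d) (Ins : ℕ → Op → (C.Dom → ℝ) → Hist)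
    {Jx : Type*} {R : Jx → (k : ℕ) → Fin d → (idx L Mf k → Matrix o o ℂ)} {α β α' β' : ℝ} (hα : 0 ≤ α) (hβ : 0 ≤ β)
    (hβ' : 0 ≤ β') (hV : ∀ j (p : o × o), LipschitzBackground L Mf (Vab L Mf (R j) p) α β)
    (hz : ∀ j (p : o × o), BoundedBackground L Mf (Zab L Mf (R j) p) α' β') {t : ℂ} (ht : ‖t‖ * kappaCol o d a α β α' < 1)
    {W : Set (ℕ → ℝ)} {cR r₀ δ : ℝ} {tow : ℕ → (ℕ → ℝ) → C.BgB → Jx} {EA : Functional C C.BgA} {EB : Functional C C.BgB}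
    {κ Λ EA₀ E₀ Gi θ' c ω ρ₀ : ℝ}
    (hread : ReadsTower Mdl (fun _ : Jx => fun k => Qlev L Mf k ⊗ₖ (1 : Matrix o o ℂ))
      (pertTower (fun k => calDalev L Mf a ha k ⊗ₖ (1 : Matrix o o ℂ)) (fun j => covPertC L Mf (R j)) t) ((L : ℝ) ^ d) W cR tow)
    (hcR : 0 ≤ cR) (hfl : ∀ k, r₀ ≤ Mdl.rOp k) (hr₀ : 0 < r₀)
    (hδ : cR * Cpert (kappaCol o d a α β α') (2 * d * Cst d a) (CJ d a) (C2col o d L a α β β') 0 t / r₀ = δ)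
    (hrA : Mdl.RepresentsA EA W) (hrB : Mdl.RepresentsB EB W) (hbase : Mdl.InBase EB W) (hlip : Mdl.DataLipschitz W κ Λ ρ₀)
    (hdA : DecayBound EA W EA₀ κ) (hdB : DecayBound EB W E₀ κ) (hreadI : (InsOpModel.ofStep Mdl Ins).ReadsIns W)
    (hienv : (InsOpModel.ofStep Mdl Ins).InsOpEnvelope W κ E₀ Gi) (hbdA : (InsOpModel.ofStep Mdl Ins).InsBoundA W κ E₀ Gi)
    (hGi : 0 ≤ Gi) (hdamp : Mdl.InsertionDampedNat W κ c ω) (hΛ : 0 ≤ Λ) (hθθ' : (L : ℝ)⁻¹ ≤ θ') (hθ'1 : θ' ≤ 1) (hc : 0 ≤ c)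
    (hω : 0 < ω) (hreachρ : c * (EA₀ + E₀) / (1 - ω) < ρ₀) (hsmall : ω + Λ * c < θ') : ∃ C₅, NE5 EA EB W κ θ' C₅ := by
  have hL : (1 : ℝ) < L := by exact_mod_cast hL1
  have hθ0 : (0 : ℝ) < (L : ℝ)⁻¹ := inv_pos.mpr (by linarith)
  have hθ1 : (L : ℝ)⁻¹ < 1 := inv_lt_one_of_one_lt₀ hL
  obtain ⟨k₁, hk₁⟩ := insReach_exists_any (δ := δ) hθ1
  obtain ⟨k₀, Bc, hBc, hnear, hfirst⟩ :=
    reach_binders_exists_any (D := δ + (Gi * δ / (1 - 1 / 2) + 2 * Gi / ((L : ℝ)⁻¹) ^ k₁)) hθ0 hθ1 hreachρ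
  exact ⟨_, ne5_at_of_colourCovariantLaplacian_lip_readsIns_nat L Mf a ha Mdl hd Ins hα hβ hβ' hV hz ht hread hcR hfl hr₀ hδ hrA hrB
    hbase hlip hdA hdB hreadI hienv hbdA hGi (by norm_num) hk₁ hdamp hΛ hθθ' hθ'1 hc hω hnear hBc hfirst hsmall⟩

/-- [folklore] `OutputRateTowerInstance.ne5_at_of_plantedPotential_lip_readsIns_nat` (King's planted unit-lattice potentials — NO binder of NE2
type; rate `L⁻¹`) with the arithmetic letters eliminated; needs `1 < L`.  King's STRUCTURE, NOT Bałaban's `Δ_a(U)`; NOT a proof of NE5. -/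
theorem exists_ne5_at_of_plantedPotential_lip_readsIns_nat (hL1 : 1 < L) (Ins : ℕ → Op → (C.Dom → ℝ) → Hist) {Jx : Type*}
    {B : Jx → Matrix (idx L Mf 0) (idx L Mf 0) ℂ} {b : ℝ} (hB : ∀ j, ‖B j‖ ≤ b) {t : ℂ} (ht : ‖t‖ * (b * Cst d a) < 1)
    {W : Set (ℕ → ℝ)} {cR r₀ δ : ℝ} {tow : ℕ → (ℕ → ℝ) → C.BgB → Jx} {EA : Functional C C.BgA} {EB : Functional C C.BgB}
    {κ Λ EA₀ E₀ Gi θ' c ω ρ₀ : ℝ}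
    (hread : ReadsTower Mdl (fun _ : Jx => Qlev L Mf) (pertTower (calDalev L Mf a ha) (fun j => plantTow L Mf (B j)) t)
      ((L : ℝ) ^ d) W cR tow)
    (hcR : 0 ≤ cR) (hfl : ∀ k, r₀ ≤ Mdl.rOp k) (hr₀ : 0 < r₀)
    (hδ : cR * Cpert (b * Cst d a) (2 * d * Cst d a) (CJ d a) 0 0 t / r₀ = δ)
    (hrA : Mdl.RepresentsA EA W) (hrB : Mdl.RepresentsB EB W) (hbase : Mdl.InBase EB W) (hlip : Mdl.DataLipschitz W κ Λ ρ₀)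
    (hdA : DecayBound EA W EA₀ κ) (hdB : DecayBound EB W E₀ κ) (hreadI : (InsOpModel.ofStep Mdl Ins).ReadsIns W)
    (hienv : (InsOpModel.ofStep Mdl Ins).InsOpEnvelope W κ E₀ Gi) (hbdA : (InsOpModel.ofStep Mdl Ins).InsBoundA W κ E₀ Gi)
    (hGi : 0 ≤ Gi) (hdamp : Mdl.InsertionDampedNat W κ c ω) (hΛ : 0 ≤ Λ) (hθθ' : (L : ℝ)⁻¹ ≤ θ') (hθ'1 : θ' ≤ 1) (hc : 0 ≤ c)
    (hω : 0 < ω) (hreachρ : c * (EA₀ + E₀) / (1 - ω) < ρ₀) (hsmall : ω + Λ * c < θ') : ∃ C₅, NE5 EA EB W κ θ' C₅ := by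
  have hL : (1 : ℝ) < L := by exact_mod_cast hL1
  have hθ0 : (0 : ℝ) < (L : ℝ)⁻¹ := inv_pos.mpr (by linarith)
  have hθ1 : (L : ℝ)⁻¹ < 1 := inv_lt_one_of_one_lt₀ hL
  obtain ⟨k₁, hk₁⟩ := insReach_exists_any (δ := δ) hθ1
  obtain ⟨k₀, Bc, hBc, hnear, hfirst⟩ :=
    reach_binders_exists_any (D := δ + (Gi * δ / (1 - 1 / 2) + 2 * Gi / ((L : ℝ)⁻¹) ^ k₁)) hθ0 hθ1 hreachρ
  exact ⟨_, ne5_at_of_plantedPotential_lip_readsIns_nat L Mf a ha Mdl Ins hB ht hread hcR hfl hr₀ hδ hrA hrB hbase hlip hdA hdB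
    hreadI hienv hbdA hGi (by norm_num) hk₁ hdamp hΛ hθθ' hθ'1 hc hω hnear hBc hfirst hsmall⟩

end RateL

end Summit.QuantumFields.BalabanUV.T4Continuum.OutputRateTowerArithmeticRate

end
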